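import Mathlib
import HarnessLib
import Literature.NumberTheory.DiophantineGeometry.AbcWave0
import Summits.ABC.ABC.Theorems.ReceptacleIdentity.Negative.TameLocalReceptacleResidueFreeLemmas
import Summits.ABC.ABC.Theorems.CongruentialReceptacleTameLocalReceptacleStubCardPrimeFactorsLe
import Summits.ABC.ABC.Theorems.CongruentialReceptacleTameLocalReceptacleStubSharedAtomsLe
import Summits.ABC.ABC.Theorems.CongruentialReceptacleTameLocalReceptacleStubCertificate

/-!
# No near-residue-free tame-local receptacle (crux `TameLocalReceptacle`, stmt-ABC-14354, line
# `SketchIdeator1`): the lead's assembly stub `stub_false_of_nearResidueFree`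

UNCONDITIONAL: the single-table form of `TameLocalReceptacle` cannot be witnessed on the `κ`-cell
(`κ ≤ 2⁻²⁵`, `ε < 2`) by an integer table that is residue-free up to a bounded perturbation `K` on
occurring data — strengthening the residue-FREE refutation `ReceptacleIdentity.Negative.
tameLocal_residueFree_false` (p101231): a witness of the crux must use the unit residues UNBOUNDEDLY.
Proof: the three-triple fourth-power certificate re-run WITH residues (`stub_certificate`); splitting
each receptacle sum over the coprime members, `S(T₁⁺) + S(T₂⁺) − S(T⁻)` = four differences of partial
sums over shared prime sets (bounded below by `−K·#primes`, `stub_sharedAtoms_le`) + the four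
valuation-`4` atoms at `s, 2, r, q` (each `≥ c₁(2−ε) log p ≥ 0` by the LOWER window); with
`ω(n) ≤ P₀ + log n/log P₀` (`stub_card_primeFactors_le`), `log P₀ ≥ 48K/(c₁(2−ε))`, and
`log x, log y, log u ≤ 4 log r + 23` this contradicts `≤ 3c₃` for `log r` large. No upper window, no modulus.
-/

-- `Summit.<Summit>.<Problem>` is the mandated summit-side namespace (CONVENTIONS §2); for the
-- single-conjunct summit `ABC` the two coincide, so the duplicate `ABC.ABC` is deliberate.
set_option linter.dupNamespace false

namespace Summit.ABC.ABC.Theorems.TameLocalReceptacle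

open Literature.NumberTheory.DiophantineGeometry
open Summit.ABC.ABC.Theorems.ReceptacleIdentity.Negative

/-! ### Splitting sums over prime supports -/

/-- A sum over the primes of `abc` (pairwise coprime, positive) splits over the three members. -/
private theorem sum_pF_triple (G : ℕ → ℤ) {a b c : ℕ} (ha : 0 < a) (hb : 0 < b) (hc : 0 < c)
    (hab : Nat.Coprime a b) (hac : Nat.Coprime a c) (hbc : Nat.Coprime b c) :
    ∑ p ∈ (a * b * c).primeFactors, G p
      = ∑ p ∈ a.primeFactors, G p + ∑ p ∈ b.primeFactors, G p + ∑ p ∈ c.primeFactors, G p := by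
  have h := sum_primeFactors_triple (fun p _ _ _ => G p) ha hb hc hab hac hbc
  simpa using h

/-- A sum over the primes of a coprime product splits. -/
private theorem sum_pF_mul (G : ℕ → ℤ) {m n : ℕ} (hm : 0 < m) (hn : 0 < n) (hmn : Nat.Coprime m n) :
    ∑ p ∈ (m * n).primeFactors, G p = ∑ p ∈ m.primeFactors, G p + ∑ p ∈ n.primeFactors, G p := by
  have h := sum_primeFactors_mul_coprime (fun p _ => G p) hm hn hmn
  simpa using h

/-- A sum over the primes of a prime power is one term. -/
private theorem sum_pF_pow (G : ℕ → ℤ) {p k : ℕ} (hp : p.Prime) (hk : k ≠ 0) :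
    ∑ q ∈ (p ^ k).primeFactors, G q = G p := by
  rw [Nat.primeFactors_prime_pow hk hp, Finset.sum_singleton]

/-! ### Small arithmetic helpers -/

/-- No prime of one member divides a coprime partner. -/
private theorem not_dvd_of_cop {p m n : ℕ} (hp : p.Prime) (h : Nat.Coprime m n) (hm : p ∣ m) :
    ¬ p ∣ n := by
  intro hn
  have h1 : p ∣ Nat.gcd m n := Nat.dvd_gcd hm hn
  rw [Nat.Coprime.gcd_eq_one h] at h1
  exact hp.one_lt.ne' (Nat.dvd_one.mp h1)

/-- Valuation zero off the support. -/
private theorem fz {p n : ℕ} (h : ¬ p ∣ n) : n.factorization p = 0 :=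
  Nat.factorization_eq_zero_of_not_dvd h

/-- Valuation of a pure prime power. -/
private theorem fpow {p k : ℕ} (hp : p.Prime) : (p ^ k).factorization p = k := by
  rw [Nat.Prime.factorization_pow hp, Finsupp.single_eq_same]

/-- Valuation of `m * n` at a prime not dividing `m`. -/
private theorem fmul_left {p m n : ℕ} (hm : m ≠ 0) (hn : n ≠ 0) (h : ¬ p ∣ m) :
    (m * n).factorization p = n.factorization p := by
  rw [Nat.factorization_mul hm hn, Finsupp.add_apply, fz h, zero_add]

/-- Valuation of `m * n` at a prime not dividing `n`. -/
private theorem fmul_right {p m n : ℕ} (hm : m ≠ 0) (hn : n ≠ 0) (h : ¬ p ∣ n) :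
    (m * n).factorization p = m.factorization p := by
  rw [Nat.factorization_mul hm hn, Finsupp.add_apply, fz h, add_zero]

/-- `log n ≤ 4 log r + 23` when `n ≤ 2³³ r⁴`, `r ≥ 1`, `n ≥ 1`. -/
private theorem log_le_of_le_pow {n r : ℕ} (hn : 0 < n) (hr : 0 < r) (h : n ≤ 2 ^ 33 * r ^ 4) :
    Real.log n ≤ 4 * Real.log r + 23 := by
  have hr' : (0 : ℝ) < r := by exact_mod_cast hr
  have hn' : (0 : ℝ) < n := by exact_mod_cast hn
  have h' : (n : ℝ) ≤ (2 : ℝ) ^ 33 * (r : ℝ) ^ 4 := by exact_mod_cast h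
  have hlog2 : Real.log 2 < 0.6931471808 := Real.log_two_lt_d9
  calc Real.log n ≤ Real.log ((2 : ℝ) ^ 33 * (r : ℝ) ^ 4) := Real.log_le_log hn' h'
    _ = 33 * Real.log 2 + 4 * Real.log r := by
        rw [Real.log_mul (by positivity) (by positivity), Real.log_pow, Real.log_pow]; push_cast; ring
    _ ≤ 4 * Real.log r + 23 := by linarith

/-! ### The assembly -/

/-- **No near-residue-free receptacle** (registered stub `stub_false_of_nearResidueFree` of the checked
skeleton of stmt-ABC-14354, line `SketchIdeator1`; lead's assembly). NO integer table with the crux's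
LOWER window (`ε < 2`) that is residue-free up to `K` on the data occurring on the `κ`-cell
(`κ ≤ 2⁻²⁵`) has receptacle sums bounded by `c₃` in absolute value on that cell (certificate
`T⁻ = (x,y,15u)`, `T₁⁺ = (x,Y,16u)`, `T₂⁺ = (X,y,15W)` of `stub_certificate`; see the module doc). [folklore] -/
theorem stub_false_of_nearResidueFree {κ ε c₁ c₃ K : ℝ} (hκ : κ ≤ 1 / 2 ^ 25) (hε : ε < 2)
    (hc₁ : 0 < c₁) (t : ℕ → ℕ → ℕ → ℕ → ℕ → ℕ → ℕ → ℤ)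
    (hw : ∀ p i j k r s z : ℕ, p.Prime →
      c₁ * (2 * ((i + j + k : ℕ) : ℝ) - 6 - ε) * Real.log p ≤ (t p i j k r s z : ℝ))
    (hB : ∀ a b c : ℕ, (IsABCTriple a b c ∧ κ * (c : ℝ) ≤ (a : ℝ) ∧ κ * (c : ℝ) ≤ (b : ℝ)) →
      |((∑ p ∈ (a * b * c).primeFactors, t p (a.factorization p) (b.factorization p)
        (c.factorization p) (a / p ^ a.factorization p % p) (b / p ^ b.factorization p % p)
        (c / p ^ c.factorization p % p) : ℤ) : ℝ)| ≤ c₃)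
    (hN : ∀ (p i j k r s z r' s' z' : ℕ), p.Prime →
      (∃ a b c : ℕ, (IsABCTriple a b c ∧ κ * (c : ℝ) ≤ (a : ℝ) ∧ κ * (c : ℝ) ≤ (b : ℝ)) ∧
        p ∈ (a * b * c).primeFactors ∧
        (a.factorization p, b.factorization p, c.factorization p, a / p ^ a.factorization p % p,
          b / p ^ b.factorization p % p, c / p ^ c.factorization p % p) = (i, j, k, r, s, z)) →
      (∃ a b c : ℕ, (IsABCTriple a b c ∧ κ * (c : ℝ) ≤ (a : ℝ) ∧ κ * (c : ℝ) ≤ (b : ℝ)) ∧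
        p ∈ (a * b * c).primeFactors ∧
        (a.factorization p, b.factorization p, c.factorization p, a / p ^ a.factorization p % p,
          b / p ^ b.factorization p % p, c / p ^ c.factorization p % p) = (i, j, k, r', s', z')) →
      |(t p i j k r s z : ℝ) - (t p i j k r' s' z' : ℝ)| ≤ K) :
    False := by
  /- Step 0: constants.  `D = c₁ (2 - ε) > 0`; slack constant `Kp = max K 0`; the prime cut-off `P₀`
  with `log P₀ ≥ 48 Kp / D`; the threshold `A` for `log r`. -/
  set D : ℝ := c₁ * (2 - ε) with hD
  have hD0 : 0 < D := mul_pos hc₁ (by linarith)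
  set Kp : ℝ := max K 0 with hKp
  have hKp0 : 0 ≤ Kp := le_max_right _ _
  have hKK : K ≤ Kp := le_max_left _ _
  set P₀ : ℕ := ⌈Real.exp (48 * Kp / D)⌉₊ + 2 with hP₀
  have hP₀2 : 2 ≤ P₀ := Nat.le_add_left 2 _
  have hP₀R : (2 : ℝ) ≤ (P₀ : ℝ) := by exact_mod_cast hP₀2
  set L : ℝ := Real.log P₀ with hL
  have hL0 : 0 < L := Real.log_pos (by linarith)
  have hLK : 48 * Kp / D ≤ L := by
    have h1 : Real.exp (48 * Kp / D) ≤ (P₀ : ℝ) := by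
      calc Real.exp (48 * Kp / D) ≤ ⌈Real.exp (48 * Kp / D)⌉₊ := Nat.le_ceil _
        _ ≤ (P₀ : ℝ) := by rw [hP₀]; push_cast; linarith
    simpa using Real.log_le_log (Real.exp_pos _) h1
  have hKL : Kp ≤ D * L / 48 := by have := (div_le_iff₀ hD0).mp hLK; linarith
  set A : ℝ := (4 / (3 * D)) * (3 * |c₃| + 3 * Kp * P₀ + 16 * Kp + 2 * D) + 1 with hA
  -- Step 1: the certificate above `R₀ = ⌈exp A⌉₊ + 1`.
  obtain ⟨r, q, s, X, W, y, Y, u, x, hR₀, hr7, hr, hq, hs, hrq, hq2r, hX, hW, hY, hyX, hu, hx, hxY,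
    hy14, hW16, hyY, hY21, hu21, hx14, hX0, hW0, hY0, hy0, hu0, hx0, cop_x_y, cop_x_Y, cop_X_y,
    cop_15_u, cop_16_u, cop_15_W, cop_x_15u, cop_y_15u, cop_x_16u, cop_Y_16u, cop_X_15W, cop_y_15W⟩ :=
    stub_certificate (⌈Real.exp A⌉₊ + 1)
  have hr0 : 0 < r := by omega
  have hrA : A < Real.log r := by
    rw [Real.lt_log_iff_exp_lt (by exact_mod_cast hr0)]
    have : ((⌈Real.exp A⌉₊ + 1 : ℕ) : ℝ) ≤ (r : ℝ) := by exact_mod_cast hR₀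
    push_cast at this; linarith [Nat.le_ceil (Real.exp A)]
  -- balance dispatcher: `c ≤ 2^25 a` in `ℕ` gives `κ c ≤ a`
  have bal : ∀ {a c : ℕ}, c ≤ 2 ^ 25 * a → κ * (c : ℝ) ≤ (a : ℝ) := fun {a c} h => by
    have h' : (c : ℝ) ≤ 2 ^ 25 * (a : ℝ) := by exact_mod_cast h
    calc κ * (c : ℝ) ≤ (1 / 2 ^ 25) * (c : ℝ) := mul_le_mul_of_nonneg_right hκ (Nat.cast_nonneg c)
      _ ≤ (a : ℝ) := by rw [one_div, inv_mul_le_iff₀ (by positivity)]; exact h'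
  have h15u : 0 < 15 * u := by omega
  have h16u : 0 < 16 * u := by omega
  have h15W : 0 < 15 * W := by omega
  -- the three balanced triples
  have T₃ : IsABCTriple x y (15 * u) ∧ κ * ((15 * u : ℕ) : ℝ) ≤ (x : ℝ) ∧
      κ * ((15 * u : ℕ) : ℝ) ≤ (y : ℝ) :=
    ⟨⟨hx0, hy0, hx, cop_x_y⟩, bal (by omega), bal (by omega)⟩
  have T₁ : IsABCTriple x Y (16 * u) ∧ κ * ((16 * u : ℕ) : ℝ) ≤ (x : ℝ) ∧
      κ * ((16 * u : ℕ) : ℝ) ≤ (Y : ℝ) :=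
    ⟨⟨hx0, hY0, hxY, cop_x_Y⟩, bal (by omega), bal (by omega)⟩
  have T₂ : IsABCTriple X y (15 * W) ∧ κ * ((15 * W : ℕ) : ℝ) ≤ (X : ℝ) ∧
      κ * ((15 * W : ℕ) : ℝ) ≤ (y : ℝ) :=
    ⟨⟨hX0, hy0, by omega, cop_X_y⟩, bal (by omega), bal (by omega)⟩
  /- Step 2: the three summands as functions of the prime, and the three bounds `|S| ≤ c₃`. -/
  let G₃ : ℕ → ℤ := fun p => t p (x.factorization p) (y.factorization p) ((15 * u).factorization p)
    (x / p ^ x.factorization p % p) (y / p ^ y.factorization p % p)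
    (15 * u / p ^ (15 * u).factorization p % p)
  let G₁ : ℕ → ℤ := fun p => t p (x.factorization p) (Y.factorization p) ((16 * u).factorization p)
    (x / p ^ x.factorization p % p) (Y / p ^ Y.factorization p % p)
    (16 * u / p ^ (16 * u).factorization p % p)
  let G₂ : ℕ → ℤ := fun p => t p (X.factorization p) (y.factorization p) ((15 * W).factorization p)
    (X / p ^ X.factorization p % p) (y / p ^ y.factorization p % p)
    (15 * W / p ^ (15 * W).factorization p % p)
  have hS₃ : |((∑ p ∈ (x * y * (15 * u)).primeFactors, G₃ p : ℤ) : ℝ)| ≤ c₃ := hB x y (15 * u) T₃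
  have hS₁ : |((∑ p ∈ (x * Y * (16 * u)).primeFactors, G₁ p : ℤ) : ℝ)| ≤ c₃ := hB x Y (16 * u) T₁
  have hS₂ : |((∑ p ∈ (X * y * (15 * W)).primeFactors, G₂ p : ℤ) : ℝ)| ≤ c₃ := hB X y (15 * W) T₂
  /- Step 3: splitting the three sums over the members. -/
  have e₃ : ∑ p ∈ (x * y * (15 * u)).primeFactors, G₃ p
      = ∑ p ∈ x.primeFactors, G₃ p + ∑ p ∈ y.primeFactors, G₃ p +
        (∑ p ∈ (15 : ℕ).primeFactors, G₃ p + ∑ p ∈ u.primeFactors, G₃ p) := by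
    rw [sum_pF_triple G₃ hx0 hy0 h15u cop_x_y cop_x_15u cop_y_15u,
      sum_pF_mul G₃ (by norm_num) hu0 cop_15_u]
  have e₁ : ∑ p ∈ (x * Y * (16 * u)).primeFactors, G₁ p
      = ∑ p ∈ x.primeFactors, G₁ p + G₁ s + (G₁ 2 + ∑ p ∈ u.primeFactors, G₁ p) := by
    rw [sum_pF_triple G₁ hx0 hY0 h16u cop_x_Y cop_x_16u cop_Y_16u,
      sum_pF_mul G₁ (by norm_num) hu0 cop_16_u, hY, sum_pF_pow G₁ hs (by norm_num),
      show (16 : ℕ) = 2 ^ 4 by norm_num, sum_pF_pow G₁ Nat.prime_two (by norm_num)]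
  have e₂ : ∑ p ∈ (X * y * (15 * W)).primeFactors, G₂ p
      = G₂ r + ∑ p ∈ y.primeFactors, G₂ p + (∑ p ∈ (15 : ℕ).primeFactors, G₂ p + G₂ q) := by
    rw [sum_pF_triple G₂ hX0 hy0 h15W cop_X_y cop_X_15W cop_y_15W,
      sum_pF_mul G₂ (by norm_num) hW0 cop_15_W, hX, sum_pF_pow G₂ hr (by norm_num), hW,
      sum_pF_pow G₂ hq (by norm_num)]
  /- Step 4: the four shared-atom comparisons (near-residue-freeness with slack `Kp`). -/
  have hNp : ∀ (p i j k r s z r' s' z' : ℕ), p.Prime →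
      (∃ a b c : ℕ, (IsABCTriple a b c ∧ κ * (c : ℝ) ≤ (a : ℝ) ∧ κ * (c : ℝ) ≤ (b : ℝ)) ∧
        p ∈ (a * b * c).primeFactors ∧
        (a.factorization p, b.factorization p, c.factorization p, a / p ^ a.factorization p % p,
          b / p ^ b.factorization p % p, c / p ^ c.factorization p % p) = (i, j, k, r, s, z)) →
      (∃ a b c : ℕ, (IsABCTriple a b c ∧ κ * (c : ℝ) ≤ (a : ℝ) ∧ κ * (c : ℝ) ≤ (b : ℝ)) ∧
        p ∈ (a * b * c).primeFactors ∧
        (a.factorization p, b.factorization p, c.factorization p, a / p ^ a.factorization p % p,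
          b / p ^ b.factorization p % p, c / p ^ c.factorization p % p) = (i, j, k, r', s', z')) →
      |(t p i j k r s z : ℝ) - (t p i j k r' s' z' : ℝ)| ≤ Kp :=
    fun p i j k r s z r' s' z' hp h1 h2 => (hN p i j k r s z r' s' z' hp h1 h2).trans hKK
  -- nonvanishing
  have hu0' : u ≠ 0 := hu0.ne'
  have hW0' : W ≠ 0 := hW0.ne'
  have hP₃0 : x * y * (15 * u) ≠ 0 := by positivity
  have hP₁0 : x * Y * (16 * u) ≠ 0 := by positivity
  have hP₂0 : X * y * (15 * W) ≠ 0 := by positivity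
  -- (a) the member `x`, A-position, partners `Y` (T₁⁺) vs `y` (T⁻)
  have cmp_x : |(∑ p ∈ x.primeFactors, (G₁ p : ℝ)) - ∑ p ∈ x.primeFactors, (G₃ p : ℝ)|
      ≤ Kp * x.primeFactors.card := by
    refine stub_sharedAtoms_le t hNp T₁ T₃ x.primeFactors
      (Nat.primeFactors_mono ⟨Y * (16 * u), by ring⟩ hP₁0)
      (Nat.primeFactors_mono ⟨y * (15 * u), by ring⟩ hP₃0) ?_
    intro p hp
    have pp := Nat.prime_of_mem_primeFactors hp
    have hpx := Nat.dvd_of_mem_primeFactors hp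
    refine ⟨rfl, ?_, ?_⟩
    · rw [fz (not_dvd_of_cop pp cop_x_Y hpx), fz (not_dvd_of_cop pp cop_x_y hpx)]
    · rw [fz (not_dvd_of_cop pp cop_x_16u hpx), fz (not_dvd_of_cop pp cop_x_15u hpx)]
  -- (b) the member `y`, B-position, partners `X` (T₂⁺) vs `x` (T⁻)
  have cmp_y : |(∑ p ∈ y.primeFactors, (G₂ p : ℝ)) - ∑ p ∈ y.primeFactors, (G₃ p : ℝ)|
      ≤ Kp * y.primeFactors.card := by
    refine stub_sharedAtoms_le t hNp T₂ T₃ y.primeFactors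
      (Nat.primeFactors_mono ⟨X * (15 * W), by ring⟩ hP₂0)
      (Nat.primeFactors_mono ⟨x * (15 * u), by ring⟩ hP₃0) ?_
    intro p hp
    have pp := Nat.prime_of_mem_primeFactors hp
    have hpy := Nat.dvd_of_mem_primeFactors hp
    refine ⟨?_, rfl, ?_⟩
    · rw [fz (not_dvd_of_cop pp cop_X_y.symm hpy), fz (not_dvd_of_cop pp cop_x_y.symm hpy)]
    · rw [fz (not_dvd_of_cop pp cop_y_15W hpy), fz (not_dvd_of_cop pp cop_y_15u hpy)]
  -- (c) the cofactor `u` of the C-members `16u` (T₁⁺) vs `15u` (T⁻), same partner `x`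
  have cmp_u : |(∑ p ∈ u.primeFactors, (G₁ p : ℝ)) - ∑ p ∈ u.primeFactors, (G₃ p : ℝ)|
      ≤ Kp * u.primeFactors.card := by
    refine stub_sharedAtoms_le t hNp T₁ T₃ u.primeFactors
      (Nat.primeFactors_mono ⟨x * Y * 16, by ring⟩ hP₁0)
      (Nat.primeFactors_mono ⟨x * y * 15, by ring⟩ hP₃0) ?_
    intro p hp
    have pp := Nat.prime_of_mem_primeFactors hp
    have hpu := Nat.dvd_of_mem_primeFactors hp
    have hp16u : p ∣ 16 * u := Dvd.dvd.mul_left hpu 16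
    have hp15u : p ∣ 15 * u := Dvd.dvd.mul_left hpu 15
    refine ⟨rfl, ?_, ?_⟩
    · rw [fz (not_dvd_of_cop pp cop_Y_16u.symm hp16u), fz (not_dvd_of_cop pp cop_y_15u.symm hp15u)]
    · rw [fmul_left (by norm_num) hu0' (not_dvd_of_cop pp cop_16_u.symm hpu),
        fmul_left (by norm_num) hu0' (not_dvd_of_cop pp cop_15_u.symm hpu)]
  -- (d) the primes of `15` in the C-members `15W` (T₂⁺) vs `15u` (T⁻)
  have cmp_15 : |(∑ p ∈ (15 : ℕ).primeFactors, (G₂ p : ℝ)) - ∑ p ∈ (15 : ℕ).primeFactors, (G₃ p : ℝ)|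
      ≤ Kp * (15 : ℕ).primeFactors.card := by
    refine stub_sharedAtoms_le t hNp T₂ T₃ (15 : ℕ).primeFactors
      (Nat.primeFactors_mono ⟨X * y * W, by ring⟩ hP₂0)
      (Nat.primeFactors_mono ⟨x * y * u, by ring⟩ hP₃0) ?_
    intro p hp
    have pp := Nat.prime_of_mem_primeFactors hp
    have hp15 := Nat.dvd_of_mem_primeFactors hp
    have hp15W : p ∣ 15 * W := Dvd.dvd.mul_right hp15 W
    have hp15u : p ∣ 15 * u := Dvd.dvd.mul_right hp15 u
    refine ⟨?_, rfl, ?_⟩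
    · rw [fz (not_dvd_of_cop pp cop_X_15W.symm hp15W), fz (not_dvd_of_cop pp cop_x_15u.symm hp15u)]
    · rw [fmul_right (by norm_num) hW0' (not_dvd_of_cop pp cop_15_W hp15),
        fmul_right (by norm_num) hu0' (not_dvd_of_cop pp cop_15_u hp15)]
  /- Step 5: the four valuation-4 atoms, bounded below by the LOWER window. -/
  have e4 : ∀ p : ℕ, c₁ * (2 * ((4 : ℕ) : ℝ) - 6 - ε) * Real.log p = D * Real.log p := by
    intro p; rw [hD]; push_cast; ring
  have hlogp : ∀ p : ℕ, 0 ≤ Real.log p := fun p => Real.log_natCast_nonneg p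
  -- at `s`: datum of T₁⁺ has exponents (0, 4, 0)
  have hsx : ¬ s ∣ x := fun h => not_dvd_of_cop hs cop_x_Y h (by rw [hY]; exact dvd_pow_self s (by norm_num))
  have hs16u : ¬ s ∣ 16 * u := fun h =>
    not_dvd_of_cop hs cop_Y_16u (by rw [hY]; exact dvd_pow_self s (by norm_num)) h
  have hYs : Y.factorization s = 4 := by rw [hY, fpow hs]
  have low_s : D * Real.log s ≤ (G₁ s : ℝ) := by
    have h := hw s (x.factorization s) (Y.factorization s) ((16 * u).factorization s)
      (x / s ^ x.factorization s % s) (Y / s ^ Y.factorization s % s)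
      (16 * u / s ^ (16 * u).factorization s % s) hs
    have hexp : ((x.factorization s + Y.factorization s + (16 * u).factorization s : ℕ) : ℝ)
        = ((4 : ℕ) : ℝ) := by rw [fz hsx, fz hs16u, hYs]
    rw [hexp, e4 s] at h
    exact h
  -- at `2`: datum of T₁⁺ has exponents (0, 0, 4)
  have h2u : ¬ 2 ∣ u := fun h => by
    have := Nat.Coprime.eq_one_of_dvd (Nat.Coprime.coprime_dvd_left (by norm_num : 2 ∣ 16) cop_16_u) h
    omega
  have h2x : ¬ 2 ∣ x := fun h => not_dvd_of_cop Nat.prime_two cop_x_16u h ⟨8 * u, by ring⟩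
  have h2Y : ¬ 2 ∣ Y := fun h => not_dvd_of_cop Nat.prime_two cop_Y_16u h ⟨8 * u, by ring⟩
  have f16u2 : (16 * u).factorization 2 = 4 := by
    rw [fmul_right (by norm_num) hu0' h2u, show (16 : ℕ) = 2 ^ 4 by norm_num, fpow Nat.prime_two]
  have low_2 : D * Real.log (2 : ℕ) ≤ (G₁ 2 : ℝ) := by
    have h := hw 2 (x.factorization 2) (Y.factorization 2) ((16 * u).factorization 2)
      (x / 2 ^ x.factorization 2 % 2) (Y / 2 ^ Y.factorization 2 % 2)
      (16 * u / 2 ^ (16 * u).factorization 2 % 2) Nat.prime_two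
    have hexp : ((x.factorization 2 + Y.factorization 2 + (16 * u).factorization 2 : ℕ) : ℝ)
        = ((4 : ℕ) : ℝ) := by rw [fz h2x, fz h2Y, f16u2]
    rw [hexp, e4 2] at h
    exact h
  -- at `r`: datum of T₂⁺ has exponents (4, 0, 0)
  have hry : ¬ r ∣ y := fun h => not_dvd_of_cop hr cop_X_y (by rw [hX]; exact dvd_pow_self r (by norm_num)) h
  have hr15W : ¬ r ∣ 15 * W := fun h =>
    not_dvd_of_cop hr cop_X_15W (by rw [hX]; exact dvd_pow_self r (by norm_num)) h
  have hXr : X.factorization r = 4 := by rw [hX, fpow hr]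
  have low_r : D * Real.log r ≤ (G₂ r : ℝ) := by
    have h := hw r (X.factorization r) (y.factorization r) ((15 * W).factorization r)
      (X / r ^ X.factorization r % r) (y / r ^ y.factorization r % r)
      (15 * W / r ^ (15 * W).factorization r % r) hr
    have hexp : ((X.factorization r + y.factorization r + (15 * W).factorization r : ℕ) : ℝ)
        = ((4 : ℕ) : ℝ) := by rw [fz hry, fz hr15W, hXr]
    rw [hexp, e4 r] at h
    exact h
  -- at `q`: datum of T₂⁺ has exponents (0, 0, 4)
  have hqW : q ∣ 15 * W := by rw [hW]; exact Dvd.dvd.mul_left (dvd_pow_self q (by norm_num)) 15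
  have hqX : ¬ q ∣ X := fun h => by
    have h1 : q ∣ r := by rw [hX] at h; exact hq.dvd_of_dvd_pow h
    have := (Nat.prime_dvd_prime_iff_eq hq hr).mp h1
    omega
  have hqy : ¬ q ∣ y := fun h => not_dvd_of_cop hq cop_y_15W.symm hqW h
  have hq15 : ¬ q ∣ 15 := fun h => by
    have h35 : q ∣ 3 * 5 := by simpa using h
    rcases (Nat.Prime.dvd_mul hq).mp h35 with h3 | h5
    · have := (Nat.prime_dvd_prime_iff_eq hq Nat.prime_three).mp h3; omega
    · have := (Nat.prime_dvd_prime_iff_eq hq (by norm_num)).mp h5; omega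
  have f15Wq : (15 * W).factorization q = 4 := by
    rw [fmul_left (by norm_num) hW0' hq15, hW, fpow hq]
  have low_q : D * Real.log q ≤ (G₂ q : ℝ) := by
    have h := hw q (X.factorization q) (y.factorization q) ((15 * W).factorization q)
      (X / q ^ X.factorization q % q) (y / q ^ y.factorization q % q)
      (15 * W / q ^ (15 * W).factorization q % q) hq
    have hexp : ((X.factorization q + y.factorization q + (15 * W).factorization q : ℕ) : ℝ)
        = ((4 : ℕ) : ℝ) := by rw [fz hqX, fz hqy, f15Wq]
    rw [hexp, e4 q] at h
    exact h
  /- Step 6: the ω-bounds. -/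
  have hWr : W ≤ 16 * r ^ 4 := by rw [← hX]; exact hW16
  have hsize_y : y ≤ 2 ^ 33 * r ^ 4 := by omega
  have hsize_u : u ≤ 2 ^ 33 * r ^ 4 := by omega
  have hsize_x : x ≤ 2 ^ 33 * r ^ 4 := by omega
  have ω_x := stub_card_primeFactors_le P₀ x hP₀2 hx0
  have ω_y := stub_card_primeFactors_le P₀ y hP₀2 hy0
  have ω_u := stub_card_primeFactors_le P₀ u hP₀2 hu0
  have lx := log_le_of_le_pow hx0 hr0 hsize_x; have ly := log_le_of_le_pow hy0 hr0 hsize_y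
  have lu := log_le_of_le_pow hu0 hr0 hsize_u
  -- `card ≤ P₀ + (4 log r + 23)/L`, and `Kp · that ≤ Kp P₀ + (D/48)(4 log r + 23)`
  have slack : ∀ {n : ℕ}, (n.primeFactors.card : ℝ) ≤ (P₀ : ℝ) + Real.log n / L →
      Real.log n ≤ 4 * Real.log r + 23 →
      Kp * n.primeFactors.card ≤ Kp * P₀ + D / 48 * (4 * Real.log r + 23) := by
    intro n hcard hlog
    have h1 : Real.log n / L ≤ (4 * Real.log r + 23) / L := div_le_div_of_nonneg_right hlog hL0.le
    have h2 : Kp * (Real.log n / L) ≤ D / 48 * (4 * Real.log r + 23) := by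
      calc Kp * (Real.log n / L) ≤ Kp * ((4 * Real.log r + 23) / L) :=
            mul_le_mul_of_nonneg_left h1 hKp0
        _ = Kp / L * (4 * Real.log r + 23) := by ring
        _ ≤ D / 48 * (4 * Real.log r + 23) := by
            apply mul_le_mul_of_nonneg_right _ (by linarith [hlogp r])
            rw [div_le_iff₀ hL0]; linarith
    calc Kp * n.primeFactors.card ≤ Kp * ((P₀ : ℝ) + Real.log n / L) :=
          mul_le_mul_of_nonneg_left hcard hKp0
      _ = Kp * P₀ + Kp * (Real.log n / L) := by ring
      _ ≤ Kp * P₀ + D / 48 * (4 * Real.log r + 23) := by linarith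
  have sx := slack ω_x lx; have sy := slack ω_y ly; have su := slack ω_u lu
  have s15 : Kp * ((15 : ℕ).primeFactors.card : ℝ) ≤ Kp * 16 := by
    apply mul_le_mul_of_nonneg_left _ hKp0
    have h1 : (15 : ℕ).primeFactors ⊆ Finset.range 16 := by
      intro p hp
      exact Finset.mem_range.mpr (Nat.lt_succ_of_le (Nat.le_of_mem_primeFactors hp))
    have h2 := Finset.card_le_card h1
    rw [Finset.card_range] at h2
    exact_mod_cast h2
  /- Step 7: the identity `S₁ + S₂ − S₃ = (four differences) + (four atoms)` and the contradiction. -/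
  have hS₃' := (abs_le.mp hS₃).1
  have hS₁' := (abs_le.mp hS₁).2
  have hS₂' := (abs_le.mp hS₂).2
  rw [e₃] at hS₃'; rw [e₁] at hS₁'; rw [e₂] at hS₂'
  push_cast at hS₃' hS₁' hS₂'
  have cx := (abs_le.mp cmp_x).1
  have cy := (abs_le.mp cmp_y).1
  have cu := (abs_le.mp cmp_u).1
  have c15 := (abs_le.mp cmp_15).1
  have hps : 0 ≤ D * Real.log s := mul_nonneg hD0.le (hlogp s)
  have hp2 : 0 ≤ D * Real.log (2 : ℕ) := mul_nonneg hD0.le (hlogp 2)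
  have hpq : 0 ≤ D * Real.log q := mul_nonneg hD0.le (hlogp q)
  -- the threshold: (3D/4) log r > 3|c₃| + 3 Kp P₀ + 16 Kp + 2 D
  have hthr : 3 * |c₃| + 3 * Kp * P₀ + 16 * Kp + 2 * D < 3 * D / 4 * Real.log r := by
    have h1 : (4 / (3 * D)) * (3 * |c₃| + 3 * Kp * P₀ + 16 * Kp + 2 * D) < Real.log r := by
      linarith
    have h2 := mul_lt_mul_of_pos_left h1 (by positivity : (0 : ℝ) < 3 * D / 4)
    have e : 3 * D / 4 * ((4 / (3 * D)) * (3 * |c₃| + 3 * Kp * P₀ + 16 * Kp + 2 * D))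
        = 3 * |c₃| + 3 * Kp * P₀ + 16 * Kp + 2 * D := by
      field_simp
    linarith
  linarith [hS₃', hS₁', hS₂', cx, cy, cu, c15, low_s, low_2, low_r, low_q, hps, hp2, hpq, sx, sy, su,
    s15, hthr, le_abs_self c₃, hD0, hKp0, hlogp r]

end Summit.ABC.ABC.Theorems.TameLocalReceptacle
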